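import Summits.ResolutionOfSingularities.ResolutionOfSingularities.Theses.Valuative
import Summits.ResolutionOfSingularities.ResolutionOfSingularities.Theorems.ValuativeLuAlphaPTorsorDenseRange2
import Summits.ResolutionOfSingularities.ResolutionOfSingularities.Theorems.ValuativeLuAlphaPTorsorRelLUAbhyankarSubfield
import Summits.ResolutionOfSingularities.ResolutionOfSingularities.Theorems.ValuativeLuAlphaPTorsorStronglySmoothTopOverAbhyankarSubfield
import Summits.ResolutionOfSingularities.ResolutionOfSingularities.Theorems.ValuativeLuAlphaPTorsorRelLUOfRegularBase
import Literature.AlgebraicGeometry.Resolution.ValuationDefect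

/-!
# `LuAlphaPTorsor` along every zero-dimensional valuation dense in an Abhyankar subfunction field — no separability hypotheses —, and the crux's defect core

Crux `Valuative.LuAlphaPTorsor` (item `stmt-ResolutionOfSingularities-0641`), line
`pfaff-line-log-final-forms`, lead seat c6 (2026-08-17), reshapes v6.7/v6.8. The dense-Abhyankar
range of Knaf–Kuhlmann 2009 (Adv. Math. 221 (2009) 428–453 = arXiv:math/0702856), Thm. 1.5, landed
in `…Theorems.ValuativeLuAlphaPTorsorDenseRange` (`denseRange`) with two separability hypotheses, is
sharpened by composing BY NAME the stubs landed in waves 2 and 3: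

* S1a `stub_abhyankarSubfieldDefectless` (Kuhlmann 2010 Thm. 1.1, `Kuhlmann2010Stability_holds`),
  S1b `stub_denseLinearIndepOnPow` (KK09 Lemma 3.12 in MacLane's form), S2
  `stub_separablyGeneratedOfLinearIndepOnPow` (MacLane) ⇒ `denseRange2`: the hypothesis "`K/F₀`
  separably generated" is AUTOMATIC;
* R0 `stub_relLUAbhyankarSubfield` (the line's any-ground-field Abhyankar theorem
  `relLU_zeroDim_abhyankar` on the subfield `F₀`), R2 `stub_stronglySmoothTopOverAbhyankarSubfield`
  (the dense chain D3/D4/D2/Lemma 3.7/Cor. 3.6 over `O_{F₀}` itself), R1 `stub_relLU_of_regularBase`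
  (KK09 Prop. 3.5, second case: smooth over a regular base is regular, EGA IV 17.5.8 (iii)
  `Grothendieck1967_17_5_8_holds`) ⇒ `denseRange3`: for ZERO-DIMENSIONAL `O` the residue-field
  separability hypothesis of Knaf–Kuhlmann 2005 is not needed either.

Upshot: **relative local uniformization along every zero-dimensional valuation ring `O ⊇ k` of a
function field `K/k` of characteristic `p` (ANY `k`) such that `K` is dense, for `v`, in a finitely
generated subfield `F₀ ⊇ k` on which `O` is an Abhyankar place** (`denseRange3`), hence the crux
there (`denseRange3_crux`); and the crux is EQUIVALENT (`luAlphaPTorsor_iff_defectCoreFinal`,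
registered anchor) to its **defect core** F⁹ (`stub_defectCoreFinal` of the registered skeleton
v6.8): the v6.4 core (zero-dimensional NON-Abhyankar valuation, closed centre of dimension `≥ 3`,
not discrete of rank one, no unit derivative, `t^p` not a `p`-th power) with the extra hypothesis
"`K` is NOT dense in any finitely generated Abhyankar subfunction field `F₀ ⊇ k`" — value group not
finitely generated, or residue field of infinite degree over `k`, or `K` immediate-but-not-dense over
every Abhyankar skeleton (the room for DEFECT): the frontier of local uniformization in positive
characteristic (dimension `3`: Cossart–Piltant; dimension `≥ 4`:
`Literature.Barriers.ResolutionOfSingularities.DimensionFourFrontier`). A planner can file F⁹ as a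
statement item and close `stmt-0641` from it by `luAlphaPTorsor_of_defectCoreFinal`.
-/

set_option linter.dupNamespace false

open IsLocalRing

namespace Summit.ResolutionOfSingularities.ResolutionOfSingularities.Theorems.PfaffLine

open Literature.AlgebraicGeometry.Resolution

/-- **Knaf–Kuhlmann 2009, Thm. 1.5 in relative form along ZERO-DIMENSIONAL valuations, with NO
separability hypotheses** (any ground field of characteristic `p`): relative local uniformization
along every zero-dimensional valuation ring `O ⊇ k` of `K/k` such that `K` is dense in a finitely
generated subfield `F₀ ⊇ k` on which `O` is an Abhyankar place. S1a + S1b + S2 (separable generation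
of `K/F₀`), R2 (the dense chain over `O_{F₀}`), R0 (regular model of the Abhyankar subfield, any
`k`) and R1 (smooth over regular is regular). [cite: KnafKuhlmann2009, Thm. 1.5] -/
theorem denseRange3 :
    ∀ p : ℕ, p.Prime → ∀ (k K : Type) [Field k] [CharP k p] [Field K] [Algebra k K] (O : ValuationSubring K), (∀ c : k, algebraMap k K c ∈ O) → (⊤ : IntermediateField k K).FG → (∀ x : K, x ∈ O → ∃ f : Polynomial k, f ≠ 0 ∧ Polynomial.aeval x f ∈ O.nonunits) → (∃ F₀ : Subfield K, (algebraMap k K).fieldRange ≤ F₀ ∧ Literature.AlgebraicGeometry.Resolution.FGOver (algebraMap k K).fieldRange F₀ ∧ Literature.AlgebraicGeometry.Resolution.IsAbhyankarPlace O (algebraMap k K).fieldRange F₀ ∧ ∀ x w : K, w ≠ 0 → ∃ a ∈ F₀, O.valuation (x - a) < O.valuation w) → ∀ (S : Subalgebra k K), S.FG → S.toSubring ≤ O.toSubring → ∃ (A : Subalgebra k K) (h : A.toSubring ≤ O.toSubring), S ≤ A ∧ A.FG ∧ IsFractionRing A K ∧ IsRegularLocalRing (Localization.AtPrime (Ideal.comap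 (Subring.inclusion h) (IsLocalRing.maximalIdeal O))) := by
  intro p hp k K _ _ _ _ O hk htopfg hzd hdense S hSfg hSO
  obtain ⟨F₀, hkF₀, hfgF₀, hAbh, hd⟩ := hdense
  haveI : CharP K p := charP_of_injective_algebraMap (algebraMap k K).injective p
  have hfgtop : FGOver F₀ (⊤ : Subfield K) := by
    obtain ⟨s, hs⟩ := htopfg
    refine ⟨s, ?_⟩
    rw [eq_top_iff]
    have h1 : (IntermediateField.adjoin k (s : Set K)).toSubfield =
        Subfield.closure (Set.range (algebraMap k K) ∪ (s : Set K)) := rfl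
    have h2 : Subfield.closure (Set.range (algebraMap k K) ∪ (s : Set K)) ≤
        Subfield.closure ((F₀ : Set K) ∪ s) :=
      Subfield.closure_mono (Set.union_subset_union_left _ fun x hx => hkF₀ (by
        obtain ⟨c, rfl⟩ := hx; exact ⟨c, rfl⟩))
    intro z _
    have hz : z ∈ (IntermediateField.adjoin k (s : Set K)).toSubfield := by rw [hs]; trivial
    rw [h1] at hz
    exact h2 hz
  have hdefl := stub_abhyankarSubfieldDefectless k K O hk F₀ hkF₀ hfgF₀ hAbh
  have hH := stub_denseLinearIndepOnPow p hp K O F₀ hdefl hd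
  have hsepgen := stub_separablyGeneratedOfLinearIndepOnPow p hp K F₀ hfgtop hH
  have hR0 := stub_relLUAbhyankarSubfield p hp k K O hk hzd F₀ hkF₀ hfgF₀ hAbh
  have hR2 := stub_stronglySmoothTopOverAbhyankarSubfield k K O htopfg F₀ hkF₀ hsepgen hd
  exact stub_relLU_of_regularBase k K O hk F₀ hkF₀ hR0 hR2 S hSfg hSO

/-- **The crux along every zero-dimensional valuation dense in an Abhyankar subfunction field**
(no separability hypotheses). [cite: KnafKuhlmann2009, Thm. 1.5] -/
theorem denseRange3_crux :
    ∀ p : ℕ, p.Prime → ∀ (k K : Type) [Field k] [CharP k p] [Field K] [Algebra k K] (O : ValuationSubring K) (A₀ : Subalgebra k K) (h₀ : A₀.toSubring ≤ O.toSubring) (t : K), A₀.FG → t ^ p ∈ A₀ → IsFractionRing (Algebra.adjoin k (insert t (A₀ : Set K))) K → (∀ x : K, x ∈ O → ∃ f : Polynomial k, f ≠ 0 ∧ Polynomial.aeval x f ∈ O.nonunits) → (∃ F₀ : Subfield K, (algebraMap k K).fieldRange ≤ F₀ ∧ Literature.AlgebraicGeometry.Resolution.FGOver (algebraMap k K).fieldRange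 F₀ ∧ Literature.AlgebraicGeometry.Resolution.IsAbhyankarPlace O (algebraMap k K).fieldRange F₀ ∧ ∀ x w : K, w ≠ 0 → ∃ a ∈ F₀, O.valuation (x - a) < O.valuation w) → ∃ (A : Subalgebra k K) (h : A.toSubring ≤ O.toSubring), A₀ ≤ A ∧ t ∈ A ∧ A.FG ∧ IsFractionRing A K ∧ IsRegularLocalRing (Localization.AtPrime (Ideal.comap (Subring.inclusion h) (IsLocalRing.maximalIdeal O))) := by
  intro p hp k K _ _ _ _ O A₀ h₀ t hfg htp hfr hzd hdense
  classical
  have hk : ∀ c : k, algebraMap k K c ∈ O := fun c => h₀ (A₀.algebraMap_mem c)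
  have htO : t ∈ O := mem_valuationSubring_of_pow_mem O hp.ne_zero (h₀ htp)
  obtain ⟨g, hg⟩ := hfg
  have htopfg : (⊤ : IntermediateField k K).FG := by
    refine ⟨insert t g, ?_⟩
    rw [eq_top_iff]
    intro z _
    haveI := hfr
    obtain ⟨a, b, -, rfl⟩ :=
      IsFractionRing.div_surjective (A := Algebra.adjoin k (insert t (A₀ : Set K))) z
    have hle : Algebra.adjoin k (insert t (A₀ : Set K)) ≤
        (IntermediateField.adjoin k ((insert t g : Finset K) : Set K)).toSubalgebra := by
      rw [← hg, Algebra.adjoin_insert_adjoin, Finset.coe_insert]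
      exact IntermediateField.algebra_adjoin_le_adjoin k _
    exact div_mem (hle a.2) (hle b.2)
  set S : Subalgebra k K := Algebra.adjoin k (insert t (A₀ : Set K)) with hS
  have hSfg : S.FG := by
    refine ⟨insert t g, ?_⟩
    rw [hS, ← hg, Algebra.adjoin_insert_adjoin, Finset.coe_insert]
  let OA : Subalgebra k K :=
    { O.toSubring with algebraMap_mem' := fun c => hk c }
  have hSOA : S ≤ OA := by
    rw [hS]
    exact Algebra.adjoin_le (Set.insert_subset htO fun z hz => h₀ hz)
  have hSO : S.toSubring ≤ O.toSubring := fun z hz => hSOA hz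
  obtain ⟨A, hAO, hSA, hAfg, hfrA, hreg⟩ := denseRange3 p hp k K O hk htopfg hzd hdense S hSfg hSO
  refine ⟨A, hAO, ?_, ?_, hAfg, hfrA, hreg⟩
  · intro z hz
    exact hSA (Algebra.subset_adjoin (Set.mem_insert_of_mem t hz))
  · exact hSA (Algebra.subset_adjoin (Set.mem_insert t _))

/-- **The crux follows from its defect core** F⁹ (the registered signature of
`stub_defectCoreFinal`, reshape v6.8, as hypothesis): the landed composition
`luAlphaPTorsor_of_nonDenseCore` (all reductions and true ranges of the line) fed with the case
split "dense in a finitely generated Abhyankar subfunction field" → `denseRange3_crux` | the core.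
[cite: KnafKuhlmann2009, Thm. 1.5] -/
theorem luAlphaPTorsor_of_defectCoreFinal
    (hcore : ∀ p : ℕ, p.Prime → ∀ (k K : Type) [Field k] [CharP k p] [Field K] [Algebra k K] (O : ValuationSubring K) (A₀ : Subalgebra k K) (h₀ : A₀.toSubring ≤ O.toSubring) (t : K), A₀.FG → ∀ (htp : t ^ p ∈ A₀), IsFractionRing (Algebra.adjoin k (insert t (A₀ : Set K))) K → IsRegularLocalRing (Localization.AtPrime (Ideal.comap (Subring.inclusion h₀) (IsLocalRing.maximalIdeal O))) → (Ideal.comap (Subring.inclusion h₀) (IsLocalRing.maximalIdeal O)).IsMaximal → (∀ x : K, x ∈ O → ∃ f : Polynomial k, f ≠ 0 ∧ Polynomial.aeval x f ∈ O.nonunits) → ¬ ringKrullDim (Localization.AtPrime (Ideal.comap (Subring.inclusion h₀) (IsLocalRing.maximalIdeal O))) ≤ 2 → ¬ Literature.AlgebraicGeometry.Resolution.IsAbhyankarPlace O (algebraMap k K).fieldRange ⊤ → ¬ (∃ F₀ : Subfield K, (algebraMap k K).fieldRange ≤ F₀ ∧ Literature.AlgebraicGeometry.Resolution.FGOver (algebraMap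 k K).fieldRange F₀ ∧ Literature.AlgebraicGeometry.Resolution.IsAbhyankarPlace O (algebraMap k K).fieldRange F₀ ∧ ∀ x w : K, w ≠ 0 → ∃ a ∈ F₀, O.valuation (x - a) < O.valuation w) → ¬ (∃ π : K, π ≠ 0 ∧ O.valuation π < 1 ∧ ∀ z : K, z ≠ 0 → ∃ n : ℤ, O.valuation z = O.valuation π ^ n) → (∀ δ : Derivation ℤ (Localization.AtPrime (Ideal.comap (Subring.inclusion h₀) (IsLocalRing.maximalIdeal O))) (Localization.AtPrime (Ideal.comap (Subring.inclusion h₀) (IsLocalRing.maximalIdeal O))), ¬ IsUnit (δ (algebraMap A₀.toSubring (Localization.AtPrime (Ideal.comap (Subring.inclusion h₀) (IsLocalRing.maximalIdeal O))) ⟨t ^ p, htp⟩))) → (∀ c : Localization.AtPrime (Ideal.comap (Subring.inclusion h₀) (IsLocalRing.maximalIdeal O)), algebraMap A₀.toSubring (Localization.AtPrime (Ideal.comap (Subring.inclusion h₀) (IsLocalRing.maximalIdeal O))) ⟨t ^ p, htp⟩ ≠ c ^ p) → ∃ (A : Subalgebra k K) (h : A.toSubring ≤ O.toSubring), A₀ ≤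 A ∧ t ∈ A ∧ A.FG ∧ IsFractionRing A K ∧ IsRegularLocalRing (Localization.AtPrime (Ideal.comap (Subring.inclusion h) (IsLocalRing.maximalIdeal O)))) :
    Summit.ResolutionOfSingularities.ResolutionOfSingularities.Theses.Valuative.LuAlphaPTorsor := by
  refine luAlphaPTorsor_of_nonDenseCore ?_
  intro p hp k K _ _ _ _ O A₀ h₀ t hfg htp hfr hreg hmax hzd hdim2 hAK hnd hdisc hδ hpow
  by_cases hdense : (∃ F₀ : Subfield K, (algebraMap k K).fieldRange ≤ F₀ ∧ Literature.AlgebraicGeometry.Resolution.FGOver (algebraMap k K).fieldRange F₀ ∧ Literature.AlgebraicGeometry.Resolution.IsAbhyankarPlace O (algebraMap k K).fieldRange F₀ ∧ ∀ x w : K, w ≠ 0 → ∃ a ∈ F₀, O.valuation (x - a) < O.valuation w)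
  · exact denseRange3_crux p hp k K O A₀ h₀ t hfg htp hfr hzd hdense
  · exact hcore p hp k K O A₀ h₀ t hfg htp hfr hreg hmax hzd hdim2 hAK hdense hdisc hδ hpow

/-- **The crux is EQUIVALENT to its defect core** F⁹ (the converse is the instance of the crux at
the core's data). [folklore] -/
theorem luAlphaPTorsor_iff_defectCoreFinal :
    Summit.ResolutionOfSingularities.ResolutionOfSingularities.Theses.Valuative.LuAlphaPTorsor ↔
    (∀ p : ℕ, p.Prime → ∀ (k K : Type) [Field k] [CharP k p] [Field K] [Algebra k K] (O : ValuationSubring K) (A₀ : Subalgebra k K) (h₀ : A₀.toSubring ≤ O.toSubring) (t : K), A₀.FG → ∀ (htp : t ^ p ∈ A₀), IsFractionRing (Algebra.adjoin k (insert t (A₀ : Set K))) K → IsRegularLocalRing (Localization.AtPrime (Ideal.comap (Subring.inclusion h₀) (IsLocalRing.maximalIdeal O))) → (Ideal.comap (Subring.inclusion h₀) (IsLocalRing.maximalIdeal O)).IsMaximal → (∀ x : K, x ∈ O → ∃ f : Polynomial k, f ≠ 0 ∧ Polynomial.aeval x f ∈ O.nonunits) → ¬ ringKrullDim (Localization.AtPrime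 (Ideal.comap (Subring.inclusion h₀) (IsLocalRing.maximalIdeal O))) ≤ 2 → ¬ Literature.AlgebraicGeometry.Resolution.IsAbhyankarPlace O (algebraMap k K).fieldRange ⊤ → ¬ (∃ F₀ : Subfield K, (algebraMap k K).fieldRange ≤ F₀ ∧ Literature.AlgebraicGeometry.Resolution.FGOver (algebraMap k K).fieldRange F₀ ∧ Literature.AlgebraicGeometry.Resolution.IsAbhyankarPlace O (algebraMap k K).fieldRange F₀ ∧ ∀ x w : K, w ≠ 0 → ∃ a ∈ F₀, O.valuation (x - a) < O.valuation w) → ¬ (∃ π : K, π ≠ 0 ∧ O.valuation π < 1 ∧ ∀ z : K, z ≠ 0 → ∃ n : ℤ, O.valuation z = O.valuation π ^ n) → (∀ δ : Derivation ℤ (Localization.AtPrime (Ideal.comap (Subring.inclusion h₀) (IsLocalRing.maximalIdeal O))) (Localization.AtPrime (Ideal.comap (Subring.inclusion h₀) (IsLocalRing.maximalIdeal O))), ¬ IsUnit (δ (algebraMap A₀.toSubring (Localization.AtPrime (Ideal.comap (Subring.inclusion h₀) (IsLocalRing.maximalIdeal O))) ⟨t ^ p, htp⟩))) → (∀ c :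 Localization.AtPrime (Ideal.comap (Subring.inclusion h₀) (IsLocalRing.maximalIdeal O)), algebraMap A₀.toSubring (Localization.AtPrime (Ideal.comap (Subring.inclusion h₀) (IsLocalRing.maximalIdeal O))) ⟨t ^ p, htp⟩ ≠ c ^ p) → ∃ (A : Subalgebra k K) (h : A.toSubring ≤ O.toSubring), A₀ ≤ A ∧ t ∈ A ∧ A.FG ∧ IsFractionRing A K ∧ IsRegularLocalRing (Localization.AtPrime (Ideal.comap (Subring.inclusion h) (IsLocalRing.maximalIdeal O)))) := by
  refine ⟨fun h => ?_, luAlphaPTorsor_of_defectCoreFinal⟩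
  intro p hp k K _ _ _ _ O A₀ h₀ t hfg htp hfr hreg _ _ _ _ _ _ _ _
  exact h p hp k K O A₀ h₀ t hfg htp hfr hreg

end Summit.ResolutionOfSingularities.ResolutionOfSingularities.Theorems.PfaffLine
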